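import Mathlib
import HarnessLib

/-!
# Crux `NT` (stmt-QuantumFields-19353): coupling WINDOWS with torus-uniform positive DENSITY feed the subsequential form
# (measure-theoretic pigeonhole)

Helper file (`--supports stmt-QuantumFields-19353`) of the fleet lead prover of crux `NT` (unit `ym-spine-19353-p1`, g29),
hypothesis-free; sequel of `…NTSubsequentialBridge` (§2 there: a coupling window `∃ γ ∈ [β, Mβ]` whose selected coupling
depends on the torus does NOT feed the bridge's subsequential demand — `not_subseq_of_octaveShape` — while a torus-uniform
selection does — `subseq_of_window_uniform`).  This file records the exact upgrade condition in between, pure measure theory: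

* `exists_frequently_mem_of_measure_ge` — in a measure space, measurable sets `A n ⊆ W` with `μ W < ∞` and `m ≤ μ (A n)` for
  infinitely many `n`, `0 < m`, have a point lying in infinitely many of them (the tails `⋃_{k} A (N + k)` decrease and have
  measure `≥ m`, so their intersection has measure `≥ m > 0`: continuity from above);
* **`subseq_of_window_density`** — if above every threshold there is a bounded coupling window `[lo, hi]` and `m > 0` such that,
  for infinitely many tori `L`, the good couplings `{γ ∈ [lo, hi] | P γ L}` form a measurable set of Lebesgue measure `≥ m`,
  then `P` holds in the subsequential form «on a cofinal set of couplings, on tori of unbounded size» consumed by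
  `Y2Bridge.yangMills_of_subseqNTLegs`.

So a window law becomes bridge-grade as soon as its good set has torus-uniform positive density — e.g. an integrated (mean-value)
law `c ≤ ∫_β^{Mβ} F_L` together with a POINTWISE, torus-uniform ceiling `F_L ≤ K` gives density by Markov's inequality; for
the k = 0 octave laws of `…NTCouplingSumRuleOctaves` the missing pointwise ceiling is finite susceptibility uniformly in the
volume (open), which is why they stay window-shaped.  HONEST FRAMING: logic and measure theory only; nothing about `NT`, floors,
the gap, or Clay. [folklore]
-/

set_option autoImplicit false

noncomputable section

open MeasureTheory Filter Topology Set

namespace Summit.QuantumFields.YangMills.Cruxes.NT.Subsequential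

/-! ## §1 Measure-theoretic pigeonhole -/

/-- **A point in infinitely many sets of measure `≥ m > 0` inside a set of finite measure.**  If `A n ⊆ W` are measurable,
`μ W < ∞`, `0 < m` and `m ≤ μ (A n)` for infinitely many `n`, some point lies in `A n` for infinitely many `n`. [folklore] -/
theorem exists_frequently_mem_of_measure_ge {X : Type*} [MeasurableSpace X] (μ : Measure X) (W : Set X) (hW : μ W ≠ ⊤)
    (A : ℕ → Set X) (hAm : ∀ n, MeasurableSet (A n)) (hAW : ∀ n, A n ⊆ W) {m : ENNReal} (hm : 0 < m)
    (hfreq : ∃ᶠ n in atTop, m ≤ μ (A n)) :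
    ∃ x : X, ∃ᶠ n in atTop, x ∈ A n := by
  -- the tails `B N = ⋃_k A (N + k)`
  set B : ℕ → Set X := fun N => ⋃ k, A (N + k) with hB
  have hBm : ∀ N, MeasurableSet (B N) := fun N => MeasurableSet.iUnion fun k => hAm (N + k)
  have hBW : ∀ N, B N ⊆ W := fun N => iUnion_subset fun k => hAW (N + k)
  have hBanti : Antitone B := by
    intro N N' hNN' x hx
    simp only [hB, mem_iUnion] at hx ⊢
    obtain ⟨k, hxk⟩ := hx
    refine ⟨N' - N + k, ?_⟩
    have : N + (N' - N + k) = N' + k := by omega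
    rw [this]; exact hxk
  have hBge : ∀ N, m ≤ μ (B N) := by
    intro N
    obtain ⟨n, hmn, hn⟩ := (hfreq.and_eventually (eventually_ge_atTop N)).exists
    refine hmn.trans (measure_mono ?_)
    have : A n = A (N + (n - N)) := by rw [Nat.add_sub_cancel' hn]
    rw [this]
    exact subset_iUnion (fun k => A (N + k)) (n - N)
  -- continuity from above
  have hinter : μ (⋂ N, B N) = ⨅ N, μ (B N) :=
    hBanti.measure_iInter (fun N => (hBm N).nullMeasurableSet)
      ⟨0, ((measure_mono (hBW 0)).trans_lt (lt_top_iff_ne_top.2 hW)).ne⟩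
  have hpos : 0 < μ (⋂ N, B N) := by
    rw [hinter]
    exact lt_of_lt_of_le hm (le_iInf hBge)
  obtain ⟨x, hx⟩ := nonempty_of_measure_ne_zero hpos.ne'
  refine ⟨x, frequently_atTop.2 fun N => ?_⟩
  have hxN : x ∈ B N := mem_iInter.1 hx N
  simp only [hB, mem_iUnion] at hxN
  obtain ⟨k, hxk⟩ := hxN
  exact ⟨N + k, Nat.le_add_right N k, hxk⟩

/-! ## §2 Windows with torus-uniform positive density feed the subsequential form -/

variable (P : ℝ → ℕ → Prop)

/-- **Coupling windows with torus-uniform positive density of good couplings feed the subsequential form.**  If above every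
threshold `B` there is a window `[lo, hi]`, `B ≤ lo`, and `m > 0` such that for infinitely many tori `L` the set of good
couplings `{γ ∈ [lo, hi] | P γ L}` is measurable with Lebesgue measure `≥ m`, then `P` holds on a cofinal set of couplings,
at each of them on tori of unbounded size. [folklore] -/
theorem subseq_of_window_density
    (h : ∀ B : ℝ, ∃ lo hi : ℝ, B ≤ lo ∧ ∃ m : ENNReal, 0 < m ∧
      (∀ L : ℕ, MeasurableSet {γ : ℝ | γ ∈ Icc lo hi ∧ P γ L}) ∧
      ∃ᶠ L in atTop, m ≤ volume {γ : ℝ | γ ∈ Icc lo hi ∧ P γ L}) :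
    ∃ Bset : Set ℝ, (∀ x : ℝ, ∃ β ∈ Bset, x ≤ β) ∧ ∀ β ∈ Bset, ∀ D : ℕ, ∃ L : ℕ, D ≤ L ∧ P β L := by
  refine ⟨{γ | ∀ D : ℕ, ∃ L : ℕ, D ≤ L ∧ P γ L}, fun x => ?_, fun β hβ D => hβ D⟩
  obtain ⟨lo, hi, hlo, m, hm, hmeas, hfreq⟩ := h x
  obtain ⟨γ, hγ⟩ := exists_frequently_mem_of_measure_ge volume (Icc lo hi) measure_Icc_lt_top.ne
    (fun L => {γ : ℝ | γ ∈ Icc lo hi ∧ P γ L}) hmeas (fun L γ hγ => hγ.1) hm hfreq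
  -- `γ` is good for infinitely many tori, and lies in the window (hence above `x`)
  obtain ⟨L₀, hγ₀⟩ := hγ.exists
  refine ⟨γ, fun D => ?_, hlo.trans hγ₀.1.1⟩
  obtain ⟨L, hγL, hL⟩ := (hγ.and_eventually (eventually_ge_atTop D)).exists
  exact ⟨L, hL, hγL.2⟩

/-- **The sequence variant**: windows indexed by `k` drifting to `+∞` (`lo k → ∞`), each with density `≥ m k > 0` of good
couplings for infinitely many tori. [folklore] -/
theorem subseq_of_window_density_seq (lo hi : ℕ → ℝ) (hlo : Tendsto lo atTop atTop) (m : ℕ → ENNReal)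
    (hm : ∀ k, 0 < m k) (hmeas : ∀ k L, MeasurableSet {γ : ℝ | γ ∈ Icc (lo k) (hi k) ∧ P γ L})
    (hfreq : ∀ k, ∃ᶠ L in atTop, m k ≤ volume {γ : ℝ | γ ∈ Icc (lo k) (hi k) ∧ P γ L}) :
    ∃ Bset : Set ℝ, (∀ x : ℝ, ∃ β ∈ Bset, x ≤ β) ∧ ∀ β ∈ Bset, ∀ D : ℕ, ∃ L : ℕ, D ≤ L ∧ P β L := by
  refine subseq_of_window_density P fun B => ?_
  obtain ⟨k, hk⟩ := (hlo.eventually_ge_atTop B).exists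
  exact ⟨lo k, hi k, hk, m k, hm k, hmeas k, hfreq k⟩

end Summit.QuantumFields.YangMills.Cruxes.NT.Subsequential

end
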